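/-
Copyright (c) 2026 the pub-hodgecm-mathlib formalisation cell (harness21).  Prover seat hodgecm-mathlib-F0P2-p06 (g12): road «S3-ram» (LEAD F0P3a-plan (g12); architect
A-p16 (g31); owner F0P3a-p06 (g15)), organ A′ (ii) (B4) G3″ «THE RESIDUAL EVALUATION OF ν»; 2026-09-02.
-/
import Literature.GroupTheory.SpecificGroups.OrthogonalThreeIsotropicPointsNilpotentForm   -- ★ p847096 (F0P3-p03 (g14)): (C3) transport, (C4) counts at the normal forms
import Literature.GroupTheory.SpecificGroups.OrthogonalThreeSymmetricNilpotentOrbits         -- ★ p846945: `exists_orthogonal_conj_eq_regularSymmetric`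
import HarnessLib

/-!
# Isotropic points of the ternary conic killed by `ᵗx (J₀Y) x`: the count for ANY nilpotent `J₀`-symmetric `Y` (by `Y² = 0` or not), and in the NORMALISED PARAMETERS
# `{∞} ⊔ {(a,b) : 2b + a² = 0}` of the conic (Wilson 2009 §3.7; Bruhat–Tits 1972 §10)

Topic `GroupTheory/SpecificGroups`; namespace `Literature.GroupTheory.SpecificGroups`.  THEOREMS ONLY (no definition, no named fact, no instance, no notation, no `sorry`);
kernel lane `--supports stmt-HodgeConjecture-24833`.  Cell `pub/hodgecm-mathlib` (crux H413), «S3-ram» seeding wave, organ A′ (ii) (B4) of the P-1-ram skeleton (architect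
A-p16 (g31)), part **G3″**: ★ `UnitaryLatticeTreeRootStarNullIsotropicCountRamified` (p847330, this seat) identifies the number `ν` of modular neighbours of a fixed
self-dual vertex through which a deep `γ` fixes everything with `#{p : ᵗx̄_p (J₀Ȳ) x̄_p = 0}`, `p` running over the normalised isotropic parameters `∞ ↦ e₃ = (0,0,1)`,
`(a,b) ↦ (1,a,b)` with `2b + a² = 0` (one per point of the conic `ᵗxJ₀x = 2x₁x₃ + x₂² = 0`); ★ `OrthogonalThreeIsotropicPointsNilpotentForm` (F0P3-p03 (g14)) counts the
killed non-zero isotropic VECTORS at the normal forms `N(c)`, `R`.  THIS FILE closes the gap: (§1) the vector count is an `O(J₀)`-conjugation invariant of `Y`, hence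
(§2) `= 2(q−1)` for every `J₀`-symmetric `Y` with `Y³ = 0 ≠ Y²` and `= q−1` for `Y² = 0 ≠ Y` (★ orbit representatives p846931∕p846945), `= q² − 1` for `Y = 0`;
(§3) non-zero isotropic vectors `=` units `×` normalised parameters, compatibly with any quadratic condition, so `(q−1)·#{p : null} = #{x ≠ 0 : null}`; (§4) hence
**`#{p : ᵗx̄_p(J₀Y)x̄_p = 0} = 2, 1, q+1`** in the three cases — the values `ν` of the blueprint's local law (B4) («regular ∕ rank-one ∕ zero residual type»).

HONEST LABEL: HC_CM is proved only modulo the 2 remaining named inputs (hLiu418 24832, h413 24833) until rung 0 closes; elementary finite-field algebra, count-neutral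
Literature seeding; nothing about the transfer is asserted.

## References
* [Wilson2009] R. A. Wilson, *The Finite Simple Groups*, GTM 251 (2009): §3.7.1 p. 70 (the `q + 1` points of a conic; isotropic vectors of ternary forms).
* [BruhatTits1972] F. Bruhat, J. Tits, *Groupes réductifs sur un corps local* I, Publ. Math. IHÉS 41 (1972): §10 (the residual building at a vertex of the ramified
  `U(3)` tree is this conic).
* [CollingwoodMcGovern1993] D. Collingwood, W. McGovern, *Nilpotent Orbits in Semisimple Lie Algebras* (1993): §9.3 (normal forms `N(c)`, `R`).
-/

set_option autoImplicit false

open Matrix Literature.NumberTheory.Automorphic Literature.NumberTheory.Automorphic.HermitianLattice Literature.NumberTheory.Automorphic.UnitaryGroup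

namespace Literature.GroupTheory.SpecificGroups

variable {K : Type*} [Field K]

/-! ## §1 The killed-isotropic count is an `O(J₀)`-conjugation invariant -/

/-- **TRANSPORT**: for `g ∈ O(J₀)`, the non-zero isotropic vectors killed by `ᵗx(J₀·gYg⁻¹)x` are the `g`-translates of those killed by `ᵗx(J₀Y)x` (★ (C3)
`dotProduct_form_conj_of_mem`, `dotProduct_antidiagonal_mulVec_of_mem`), so the two counts agree. [cite: Wilson2009, §3.7.1 p. 70] -/
theorem ncard_isotropic_form_conj_eq {g : GL (Fin 3) K} (hg : g ∈ unitaryGroupOfForm (RingHom.id K) ((StdForm.antidiagonal 3).over K))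
    (Y : Matrix (Fin 3) (Fin 3) K) :
    {x : Fin 3 → K | x ≠ 0 ∧ x ⬝ᵥ (((StdForm.antidiagonal 3).over K) *ᵥ x) = 0 ∧
        x ⬝ᵥ (((StdForm.antidiagonal 3).over K * ((g : Matrix (Fin 3) (Fin 3) K) * Y * ((g⁻¹ : GL (Fin 3) K) : Matrix (Fin 3) (Fin 3) K))) *ᵥ x) = 0}.ncard =
      {x : Fin 3 → K | x ≠ 0 ∧ x ⬝ᵥ (((StdForm.antidiagonal 3).over K) *ᵥ x) = 0 ∧ x ⬝ᵥ (((StdForm.antidiagonal 3).over K * Y) *ᵥ x) = 0}.ncard := by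
  have hinv : ∀ x : Fin 3 → K, ((g⁻¹ : GL (Fin 3) K) : Matrix (Fin 3) (Fin 3) K) *ᵥ ((g : Matrix (Fin 3) (Fin 3) K) *ᵥ x) = x := fun x => by
    rw [Matrix.mulVec_mulVec, ← Units.val_mul, inv_mul_cancel, Units.val_one, Matrix.one_mulVec]
  have hinv' : ∀ x : Fin 3 → K, (g : Matrix (Fin 3) (Fin 3) K) *ᵥ (((g⁻¹ : GL (Fin 3) K) : Matrix (Fin 3) (Fin 3) K) *ᵥ x) = x := fun x => by
    rw [Matrix.mulVec_mulVec, ← Units.val_mul, mul_inv_cancel, Units.val_one, Matrix.one_mulVec]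
  have himage : {x : Fin 3 → K | x ≠ 0 ∧ x ⬝ᵥ (((StdForm.antidiagonal 3).over K) *ᵥ x) = 0 ∧
        x ⬝ᵥ (((StdForm.antidiagonal 3).over K * ((g : Matrix (Fin 3) (Fin 3) K) * Y * ((g⁻¹ : GL (Fin 3) K) : Matrix (Fin 3) (Fin 3) K))) *ᵥ x) = 0} =
      (fun x => (g : Matrix (Fin 3) (Fin 3) K) *ᵥ x) ''
        {x : Fin 3 → K | x ≠ 0 ∧ x ⬝ᵥ (((StdForm.antidiagonal 3).over K) *ᵥ x) = 0 ∧ x ⬝ᵥ (((StdForm.antidiagonal 3).over K * Y) *ᵥ x) = 0} := by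
    ext x
    simp only [Set.mem_setOf_eq, Set.mem_image]
    constructor
    · rintro ⟨hx0, hiso, hnull⟩
      refine ⟨((g⁻¹ : GL (Fin 3) K) : Matrix (Fin 3) (Fin 3) K) *ᵥ x, ⟨fun h0 => hx0 ?_, ?_, ?_⟩, hinv' x⟩
      · rw [← hinv' x, h0, Matrix.mulVec_zero]
      · rw [← dotProduct_antidiagonal_mulVec_of_mem hg, hinv' x]; exact hiso
      · rw [← dotProduct_form_conj_of_mem hg Y x]; exact hnull
    · rintro ⟨x', ⟨hx'0, hiso', hnull'⟩, rfl⟩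
      refine ⟨fun h0 => hx'0 ?_, ?_, ?_⟩
      · rw [← hinv x', h0, Matrix.mulVec_zero]
      · rw [dotProduct_antidiagonal_mulVec_of_mem hg]; exact hiso'
      · rw [dotProduct_form_conj_of_mem hg Y, hinv x']; exact hnull'
  rw [himage, Set.ncard_image_of_injective _ (fun x x' (h : (g : Matrix (Fin 3) (Fin 3) K) *ᵥ x = (g : Matrix (Fin 3) (Fin 3) K) *ᵥ x') => by
    rw [← hinv x, ← hinv x', h])]

/-! ## §2 The count for any `Y` in the two nilpotent orbits, and for `Y = 0` -/

section Counts

variable [Fintype K]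

/-- **TWO POINTS for `Y ~ R`**: if `gYg⁻¹ = R` for some `g ∈ O(J₀)`, the killed non-zero isotropic vectors number `2(q − 1)`. [cite: Wilson2009, §3.7.1 p. 70] -/
theorem ncard_isotropic_form_eq_of_conj_regularSymmetric (h2 : (2 : K) ≠ 0) {g : GL (Fin 3) K}
    (hg : g ∈ unitaryGroupOfForm (RingHom.id K) ((StdForm.antidiagonal 3).over K)) {Y : Matrix (Fin 3) (Fin 3) K}
    (hY : (g : Matrix (Fin 3) (Fin 3) K) * Y * ((g⁻¹ : GL (Fin 3) K) : Matrix (Fin 3) (Fin 3) K) = !![0, 0, 0; 1, 0, 0; 0, 1, 0]) :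
    {x : Fin 3 → K | x ≠ 0 ∧ x ⬝ᵥ (((StdForm.antidiagonal 3).over K) *ᵥ x) = 0 ∧ x ⬝ᵥ (((StdForm.antidiagonal 3).over K * Y) *ᵥ x) = 0}.ncard =
      2 * (Fintype.card K - 1) := by
  rw [← ncard_isotropic_form_conj_eq hg Y, hY]
  exact ncard_isotropic_regularSymmetric_form_eq_zero h2

/-- **ONE POINT for `Y ~ N(c)`**: if `gYg⁻¹ = N(c)`, `c ≠ 0`, for some `g ∈ O(J₀)`, the killed non-zero isotropic vectors number `q − 1`. [cite: Wilson2009, §3.7.1 p. 70] -/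
theorem ncard_isotropic_form_eq_of_conj_cornerSymmetric {g : GL (Fin 3) K}
    (hg : g ∈ unitaryGroupOfForm (RingHom.id K) ((StdForm.antidiagonal 3).over K)) {c : K} (hc : c ≠ 0) {Y : Matrix (Fin 3) (Fin 3) K}
    (hY : (g : Matrix (Fin 3) (Fin 3) K) * Y * ((g⁻¹ : GL (Fin 3) K) : Matrix (Fin 3) (Fin 3) K) = !![0, 0, 0; 0, 0, 0; c, 0, 0]) :
    {x : Fin 3 → K | x ≠ 0 ∧ x ⬝ᵥ (((StdForm.antidiagonal 3).over K) *ᵥ x) = 0 ∧ x ⬝ᵥ (((StdForm.antidiagonal 3).over K * Y) *ᵥ x) = 0}.ncard =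
      Fintype.card K - 1 := by
  rw [← ncard_isotropic_form_conj_eq hg Y, hY]
  exact ncard_isotropic_cornerSymmetric_form_eq_zero hc

/-- **TWO POINTS for a REGULAR nilpotent `J₀`-symmetric `Y`** (`Y³ = 0`, `Y² ≠ 0`, `2 ≠ 0`; ★ `exists_orthogonal_conj_eq_regularSymmetric`). [cite: Wilson2009, §3.7.1 p. 70]
[cite: CollingwoodMcGovern1993, §9.3] -/
theorem ncard_isotropic_form_eq_of_sq_ne_zero (h2 : (2 : K) ≠ 0) {Y : Matrix (Fin 3) (Fin 3) K}
    (hYs : ((StdForm.antidiagonal 3).over K)⁻¹ * (Y.map (RingHom.id K))ᵀ * (StdForm.antidiagonal 3).over K = Y) (h3 : Y ^ 3 = 0) (hsq : Y * Y ≠ 0) :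
    {x : Fin 3 → K | x ≠ 0 ∧ x ⬝ᵥ (((StdForm.antidiagonal 3).over K) *ᵥ x) = 0 ∧ x ⬝ᵥ (((StdForm.antidiagonal 3).over K * Y) *ᵥ x) = 0}.ncard =
      2 * (Fintype.card K - 1) := by
  obtain ⟨g, hg, hY⟩ := exists_orthogonal_conj_eq_regularSymmetric h2 hYs h3 hsq
  exact ncard_isotropic_form_eq_of_conj_regularSymmetric h2 hg hY

/-- **ONE POINT for a RANK-ONE nilpotent `J₀`-symmetric `Y`** (`Y² = 0`, `Y ≠ 0`; ★ `exists_orthogonal_conj_eq_cornerSymmetric`, either square class).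
[cite: Wilson2009, §3.7.1 p. 70] [cite: CollingwoodMcGovern1993, §9.3] -/
theorem ncard_isotropic_form_eq_of_sq_eq_zero {Y : Matrix (Fin 3) (Fin 3) K}
    (hYs : ((StdForm.antidiagonal 3).over K)⁻¹ * (Y.map (RingHom.id K))ᵀ * (StdForm.antidiagonal 3).over K = Y) (h0 : Y * Y = 0) (hne : Y ≠ 0) :
    {x : Fin 3 → K | x ≠ 0 ∧ x ⬝ᵥ (((StdForm.antidiagonal 3).over K) *ᵥ x) = 0 ∧ x ⬝ᵥ (((StdForm.antidiagonal 3).over K * Y) *ᵥ x) = 0}.ncard =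
      Fintype.card K - 1 := by
  obtain ⟨c, hc, g, hg, hY⟩ := exists_orthogonal_conj_eq_cornerSymmetric hYs h0 hne
  exact ncard_isotropic_form_eq_of_conj_cornerSymmetric hg hc hY

/-- **ALL `q + 1` POINTS for `Y = 0`**: the killed vectors are all `q² − 1` non-zero isotropic vectors (★ `ncard_isotropic_ne_zero`). [cite: Wilson2009, §3.7.1 p. 70] -/
theorem ncard_isotropic_form_zero (h2 : (2 : K) ≠ 0) :
    {x : Fin 3 → K | x ≠ 0 ∧ x ⬝ᵥ (((StdForm.antidiagonal 3).over K) *ᵥ x) = 0 ∧ x ⬝ᵥ (((StdForm.antidiagonal 3).over K * 0) *ᵥ x) = 0}.ncard =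
      Fintype.card K ^ 2 - 1 := by
  rw [← ncard_isotropic_ne_zero h2]
  congr 1
  ext x
  simp only [Set.mem_setOf_eq, Matrix.mul_zero, Matrix.zero_mulVec, dotProduct_zero, and_true]

end Counts

/-! ## §3 Non-zero isotropic vectors = units × normalised parameters -/

section Params

/-- The normalised vector of a parameter is ISOTROPIC: `e₃`, and `(1,a,b)` with `2b + a² = 0`. [cite: Wilson2009, §3.7.1 p. 70] -/
theorem normalParam_isotropic (p : Option {p : K × K // p.2 + (RingHom.id K) p.2 + p.1 * (RingHom.id K) p.1 = 0}) :
    (p.elim (Pi.single 2 1) fun q => ![(1 : K), q.1.1, q.1.2]) ⬝ᵥ (((StdForm.antidiagonal 3).over K) *ᵥ (p.elim (Pi.single 2 1) fun q => ![(1 : K), q.1.1, q.1.2])) = 0 := by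
  rcases p with _ | ⟨⟨a, b⟩, hab⟩
  · rw [dotProduct_antidiagonal_three_mulVec]; simp
  · simp only [RingHom.id_apply] at hab
    rw [dotProduct_antidiagonal_three_mulVec]
    simp only [Option.elim_some, Matrix.cons_val_zero, Matrix.cons_val_one, Matrix.cons_val_two, Matrix.head_cons, Matrix.tail_cons]
    linear_combination hab

/-- The normalised vector of a parameter is NON-ZERO. [cite: Wilson2009, §3.7.1 p. 70] -/
theorem normalParam_ne_zero (p : Option {p : K × K // p.2 + (RingHom.id K) p.2 + p.1 * (RingHom.id K) p.1 = 0}) :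
    (p.elim (Pi.single 2 1) fun q => ![(1 : K), q.1.1, q.1.2]) ≠ 0 := by
  rcases p with _ | q
  · intro h; have h2 := congrFun h 2; simp at h2
  · intro h; have h0 := congrFun h 0; simp at h0

/-- Quadratic conditions are HOMOGENEOUS: `ᵗ(cx) A (cx) = c²·ᵗxAx`. [cite: Wilson2009, §3.7.1 p. 70] -/
theorem dotProduct_smul_mulVec_smul (A : Matrix (Fin 3) (Fin 3) K) (c : K) (x : Fin 3 → K) :
    (c • x) ⬝ᵥ (A *ᵥ (c • x)) = c * c * (x ⬝ᵥ (A *ᵥ x)) := by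
  rw [Matrix.mulVec_smul, dotProduct_smul, smul_dotProduct, smul_eq_mul, smul_eq_mul, mul_assoc]

/-- **UNIQUENESS**: `c·x_p = c′·x_{p′}` with `c, c′ ≠ 0` forces `c = c′` and `p = p′`. [cite: Wilson2009, §3.7.1 p. 70] -/
theorem eq_and_eq_of_smul_normalParam_eq {c c' : K} (hc : c ≠ 0) (hc' : c' ≠ 0) {p p' : Option {p : K × K // p.2 + (RingHom.id K) p.2 + p.1 * (RingHom.id K) p.1 = 0}}
    (h : c • (p.elim (Pi.single 2 1) fun q => ![(1 : K), q.1.1, q.1.2]) = c' • (p'.elim (Pi.single 2 1) fun q => ![(1 : K), q.1.1, q.1.2])) : c = c' ∧ p = p' := by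
  rcases p with _ | ⟨⟨a, b⟩, hab⟩ <;> rcases p' with _ | ⟨⟨a', b'⟩, hab'⟩
  · have h2 := congrFun h 2
    simp at h2
    exact ⟨h2, rfl⟩
  · have h0 := congrFun h 0
    simp at h0
    exact absurd h0.symm hc'
  · have h0 := congrFun h 0
    simp at h0
    exact absurd h0 hc
  · have h0 := congrFun h 0
    have h1 := congrFun h 1
    have h2 := congrFun h 2
    simp at h0 h1 h2
    subst h0
    have ha : a = a' := mul_left_cancel₀ hc h1
    have hb : b = b' := mul_left_cancel₀ hc h2
    subst ha hb
    exact ⟨rfl, rfl⟩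

/-- **EXISTENCE**: every non-zero isotropic vector is `c·x_p` for a unit `c` and a normalised parameter `p` (`x₁ = 0` forces `x₂ = 0`, `x = x₃e₃`; else divide by `x₁`).
[cite: Wilson2009, §3.7.1 p. 70] -/
theorem exists_smul_normalParam_eq_of_isotropic {x : Fin 3 → K} (hx0 : x ≠ 0) (hiso : x ⬝ᵥ (((StdForm.antidiagonal 3).over K) *ᵥ x) = 0) :
    ∃ c : K, c ≠ 0 ∧ ∃ p : Option {p : K × K // p.2 + (RingHom.id K) p.2 + p.1 * (RingHom.id K) p.1 = 0},
      x = c • (p.elim (Pi.single 2 1) fun q => ![(1 : K), q.1.1, q.1.2]) := by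
  rw [dotProduct_antidiagonal_three_mulVec] at hiso
  by_cases h0 : x 0 = 0
  · have h1 : x 1 = 0 := by
      rw [h0, zero_mul, mul_zero, zero_add, add_zero] at hiso
      exact mul_self_eq_zero.1 hiso
    have h2 : x 2 ≠ 0 := by
      intro h2; apply hx0; funext i; fin_cases i
      · exact h0
      · exact h1
      · exact h2
    refine ⟨x 2, h2, none, ?_⟩
    funext i; fin_cases i <;> simp [h0, h1]
  · refine ⟨x 0, h0, some ⟨(x 1 / x 0, x 2 / x 0), ?_⟩, ?_⟩
    · simp only [RingHom.id_apply]
      field_simp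
      linear_combination hiso
    · funext i; fin_cases i <;> simp <;> field_simp

variable [Finite K]

/-- **`(q − 1)·#{p : ᵗx_p(J₀M)x_p = 0} = #{x ≠ 0 : ᵗxJ₀x = 0 ∧ ᵗx(J₀M)x = 0}`** for ANY matrix `M`: units `×` null normalised parameters `≃` non-zero null isotropic vectors
via `(c, p) ↦ c·x_p` (§3 uniqueness∕existence + homogeneity). [cite: Wilson2009, §3.7.1 p. 70] [cite: BruhatTits1972, §10] -/
theorem card_sub_one_mul_natCard_nullParams_eq_ncard (M : Matrix (Fin 3) (Fin 3) K) :
    (Nat.card K - 1) * Nat.card {p : Option {p : K × K // p.2 + (RingHom.id K) p.2 + p.1 * (RingHom.id K) p.1 = 0} // (p.elim (Pi.single 2 1) fun q => ![(1 : K), q.1.1, q.1.2]) ⬝ᵥ ((((StdForm.antidiagonal 3).over K) * M) *ᵥ (p.elim (Pi.single 2 1) fun q => ![(1 : K), q.1.1, q.1.2])) = 0} =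
      {x : Fin 3 → K | x ≠ 0 ∧ x ⬝ᵥ (((StdForm.antidiagonal 3).over K) *ᵥ x) = 0 ∧ x ⬝ᵥ ((((StdForm.antidiagonal 3).over K) * M) *ᵥ x) = 0}.ncard := by
  classical
  haveI := Fintype.ofFinite K
  rw [← Nat.card_coe_set_eq, Nat.card_eq_fintype_card (α := K), ← Fintype.card_units, ← Nat.card_eq_fintype_card, ← Nat.card_prod]
  refine Nat.card_congr (Equiv.ofBijective
    (fun cp : Kˣ × {p : Option {p : K × K // p.2 + (RingHom.id K) p.2 + p.1 * (RingHom.id K) p.1 = 0} // (p.elim (Pi.single 2 1) fun q => ![(1 : K), q.1.1, q.1.2]) ⬝ᵥ ((((StdForm.antidiagonal 3).over K) * M) *ᵥ (p.elim (Pi.single 2 1) fun q => ![(1 : K), q.1.1, q.1.2])) = 0} =>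
      (⟨(cp.1 : K) • (cp.2.1.elim (Pi.single 2 1) fun q => ![(1 : K), q.1.1, q.1.2]),
        ⟨smul_ne_zero (Units.ne_zero cp.1) (normalParam_ne_zero cp.2.1),
          by rw [dotProduct_smul_mulVec_smul, normalParam_isotropic, mul_zero],
          by rw [dotProduct_smul_mulVec_smul, cp.2.2, mul_zero]⟩⟩ : {x : Fin 3 → K | x ≠ 0 ∧ x ⬝ᵥ (((StdForm.antidiagonal 3).over K) *ᵥ x) = 0 ∧ x ⬝ᵥ ((((StdForm.antidiagonal 3).over K) * M) *ᵥ x) = 0})) ⟨?_, ?_⟩)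
  · rintro ⟨c, p⟩ ⟨c', p'⟩ h
    have h' := congrArg Subtype.val h
    obtain ⟨hc, hp⟩ := eq_and_eq_of_smul_normalParam_eq (Units.ne_zero c) (Units.ne_zero c') h'
    exact Prod.ext (Units.ext hc) (Subtype.ext hp)
  · rintro ⟨x, hx0, hiso, hnull⟩
    obtain ⟨c, hc, p, rfl⟩ := exists_smul_normalParam_eq_of_isotropic hx0 hiso
    have hp : (p.elim (Pi.single 2 1) fun q => ![(1 : K), q.1.1, q.1.2]) ⬝ᵥ ((((StdForm.antidiagonal 3).over K) * M) *ᵥ (p.elim (Pi.single 2 1) fun q => ![(1 : K), q.1.1, q.1.2])) = 0 := by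
      rw [dotProduct_smul_mulVec_smul] at hnull
      rcases mul_eq_zero.1 hnull with h | h
      · exact absurd (mul_self_eq_zero.1 h) hc
      · exact h
    exact ⟨(Units.mk0 c hc, ⟨p, hp⟩), Subtype.ext (by simp)⟩

/-! ## §4 The values of `ν`: `2`, `1`, `q + 1` -/

/-- **`ν = 2` FOR A REGULAR NILPOTENT `J₀`-SYMMETRIC `Y`** (`Y³ = 0 ≠ Y²`, `2 ≠ 0`): two `Q_Y`-null normalised isotropic parameters. [cite: Wilson2009, §3.7.1 p. 70]
[cite: CollingwoodMcGovern1993, §9.3] [cite: BruhatTits1972, §10] -/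
theorem natCard_nullParams_eq_two_of_sq_ne_zero (h2 : (2 : K) ≠ 0) {Y : Matrix (Fin 3) (Fin 3) K}
    (hYs : ((StdForm.antidiagonal 3).over K)⁻¹ * (Y.map (RingHom.id K))ᵀ * (StdForm.antidiagonal 3).over K = Y) (h3 : Y ^ 3 = 0) (hsq : Y * Y ≠ 0) :
    Nat.card {p : Option {p : K × K // p.2 + (RingHom.id K) p.2 + p.1 * (RingHom.id K) p.1 = 0} // (p.elim (Pi.single 2 1) fun q => ![(1 : K), q.1.1, q.1.2]) ⬝ᵥ ((((StdForm.antidiagonal 3).over K) * Y) *ᵥ (p.elim (Pi.single 2 1) fun q => ![(1 : K), q.1.1, q.1.2])) = 0} = 2 := by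
  classical
  haveI := Fintype.ofFinite K
  have h := card_sub_one_mul_natCard_nullParams_eq_ncard Y
  rw [ncard_isotropic_form_eq_of_sq_ne_zero h2 hYs h3 hsq, Nat.card_eq_fintype_card, mul_comm 2] at h
  exact Nat.eq_of_mul_eq_mul_left (Nat.sub_pos_of_lt Fintype.one_lt_card) h

/-- **`ν = 1` FOR A RANK-ONE NILPOTENT `J₀`-SYMMETRIC `Y`** (`Y² = 0 ≠ Y`): one `Q_Y`-null normalised isotropic parameter (either square class). [cite: Wilson2009, §3.7.1 p. 70]
[cite: CollingwoodMcGovern1993, §9.3] [cite: BruhatTits1972, §10] -/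
theorem natCard_nullParams_eq_one_of_sq_eq_zero {Y : Matrix (Fin 3) (Fin 3) K}
    (hYs : ((StdForm.antidiagonal 3).over K)⁻¹ * (Y.map (RingHom.id K))ᵀ * (StdForm.antidiagonal 3).over K = Y) (h0 : Y * Y = 0) (hne : Y ≠ 0) :
    Nat.card {p : Option {p : K × K // p.2 + (RingHom.id K) p.2 + p.1 * (RingHom.id K) p.1 = 0} // (p.elim (Pi.single 2 1) fun q => ![(1 : K), q.1.1, q.1.2]) ⬝ᵥ ((((StdForm.antidiagonal 3).over K) * Y) *ᵥ (p.elim (Pi.single 2 1) fun q => ![(1 : K), q.1.1, q.1.2])) = 0} = 1 := by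
  classical
  haveI := Fintype.ofFinite K
  have h := card_sub_one_mul_natCard_nullParams_eq_ncard Y
  rw [ncard_isotropic_form_eq_of_sq_eq_zero hYs h0 hne, Nat.card_eq_fintype_card] at h
  have h' : (Fintype.card K - 1) * Nat.card {p : Option {p : K × K // p.2 + (RingHom.id K) p.2 + p.1 * (RingHom.id K) p.1 = 0} // (p.elim (Pi.single 2 1) fun q => ![(1 : K), q.1.1, q.1.2]) ⬝ᵥ ((((StdForm.antidiagonal 3).over K) * Y) *ᵥ (p.elim (Pi.single 2 1) fun q => ![(1 : K), q.1.1, q.1.2])) = 0} = (Fintype.card K - 1) * 1 := by rw [h, mul_one]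
  exact Nat.eq_of_mul_eq_mul_left (Nat.sub_pos_of_lt Fintype.one_lt_card) h'

/-- **`ν = q + 1` FOR `Y = 0`**: every normalised isotropic parameter is null (the whole conic). [cite: Wilson2009, §3.7.1 p. 70] [cite: BruhatTits1972, §10] -/
theorem natCard_nullParams_zero (h2 : (2 : K) ≠ 0) :
    Nat.card {p : Option {p : K × K // p.2 + (RingHom.id K) p.2 + p.1 * (RingHom.id K) p.1 = 0} // (p.elim (Pi.single 2 1) fun q => ![(1 : K), q.1.1, q.1.2]) ⬝ᵥ ((((StdForm.antidiagonal 3).over K) * 0) *ᵥ (p.elim (Pi.single 2 1) fun q => ![(1 : K), q.1.1, q.1.2])) = 0} = Nat.card K + 1 := by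
  classical
  haveI := Fintype.ofFinite K
  have h := card_sub_one_mul_natCard_nullParams_eq_ncard (0 : Matrix (Fin 3) (Fin 3) K)
  rw [ncard_isotropic_form_zero h2, Nat.card_eq_fintype_card] at h
  have hsq : Fintype.card K ^ 2 - 1 = (Fintype.card K - 1) * (Fintype.card K + 1) := by
    rw [show Fintype.card K ^ 2 - 1 = Fintype.card K ^ 2 - 1 ^ 2 by rw [one_pow], Nat.sq_sub_sq, mul_comm]
  rw [hsq] at h
  rw [Nat.card_eq_fintype_card (α := K)]
  exact Nat.eq_of_mul_eq_mul_left (Nat.sub_pos_of_lt Fintype.one_lt_card) h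

end Params

end Literature.GroupTheory.SpecificGroups
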